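import Summits.AnomalousDissipation.AnomalousDissipation.Theses.WazewskiBlock
import Summits.AnomalousDissipation.AnomalousDissipation.Theorems.WazewskiBlockUniformWorkFloorTrapStubSteadyTransfer
import Literature.Analysis.FluidPDE.SteadyGalerkinApprox
import Literature.Analysis.FluidPDE.NSGalerkinTrajectory
import Literature.Analysis.FluidPDE.NSHopfGalerkin
import Literature.Analysis.FunctionSpaces.TorusTrigPoly
import Literature.Analysis.FunctionSpaces.TorusFourierModes
import Literature.Analysis.FunctionSpaces.TorusHNegOnePairing
import Literature.Analysis.FunctionSpaces.TorusInverseLaplacian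
import Literature.Analysis.FunctionSpaces.TorusInverseLaplacianCalculus
import Literature.Analysis.FunctionSpaces.TorusLerayHelmholtz
import Literature.Analysis.FunctionSpaces.TorusTestFunction
import Literature.Analysis.FunctionSpaces.TorusCalculusProofs
import Literature.Analysis.FunctionSpaces.TorusLinearisedFormTruncation

/-!
# Route `WazewskiBlock`, crux `UniformWorkFloorTrap` (stmt-AnomalousDissipation-10353):
# with viscosity-DEPENDENT block constants the crux is a theorem

Definition-free support file of the line `Sketch` (lead c1).  The crux reads
`∃ f, ∃ E ε₀ ν₀, ∀ ν ≤ ν₀, ∃ N₀, ∀ N ≥ N₀, ∃` a global Galerkin trajectory of order `N` trapped in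
`{kineticEnergy ≤ E} ∩ {(f,·) ≥ ε₀}` for all `t ≥ 0`.  This file proves the statement obtained by
moving `∃ E ε₀` INSIDE `∀ ν` — for EVERY nonzero mean-zero Galerkin-mode force and every `ν > 0`,
with the explicit `N₀ = m` (the order of the force) — so that, together with
`UniformWorkFloorTrap.not_uniformWorkFloorTrap_fixedResolution` (a `ν`-uniform `N₀` is impossible),
the whole content of the crux is pinned on the `ν`-UNIFORMITY of the pair `(E, ε₀)`:

* `steady_allModes_of_punctured` — dictionary: the tested steady Galerkin equations against the
  smooth divergence-free fields band-limited to the punctured ball `0 < |k|² ≤ N²` (the bracket of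
  `Literature.Analysis.FluidPDE.exists_steady_galerkin_approx`, Temam 1979 Ch. II (1.25)) imply the
  tested equations against EVERY Galerkin mode of order `N` when the force has zero mean (a Galerkin
  mode is its mean plus a punctured-band-limited field; constants test to `⟪∫f, c⟫ = 0`);
* `energy_lower_bound_of_steady` — **every Galerkin steady state is bounded away from zero,
  uniformly in `N`**: testing with `a := f` gives `‖f‖₂² ≤ M_f ∫‖U‖² + ν ‖Δf‖₂ (∫‖U‖²)^{1/2}` with
  `M_f = sup_x ∑ᵢ ‖∂ᵢ f(x)‖`;
* `trapped_steady_family` — for `ν > 0` and a nonzero mean-zero Galerkin-mode force `f` of order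
  `m` there are `E = ‖f‖₂²/(2(4π²ν)²)` and `ε₀ = ε₀(ν, f) > 0` such that for EVERY `N ≥ m` the
  stationary Galerkin approximation `u_N` (Temam's `u_m`: smooth, divergence free, mean zero,
  `ν‖∇u_N‖² = (f, u_N)`, a priori bound `(4π²ν)² Σ|k|²‖û_N(k)‖² ≤ ‖f‖₂²`) is, as a constant curve, a
  global Galerkin trajectory of order `N` trapped in `{kineticEnergy ≤ E} ∩ {(f,·) ≥ ε₀}`
  (`Sketch.stub_steadyTransfer`, p103729): loudness `(f,u_N) = ν‖∇u_N‖² ≥ 4π²ν ∫‖u_N‖² ≥ ε₀` by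
  Poincaré on the punctured ball and the lower bound;
* `uniformWorkFloorTrap_nuDependent` — the crux-shaped corollary with the swapped quantifiers
  `∀ ν > 0, ∃ E ε₀ > 0, ∃ N₀, ∀ N ≥ N₀, ∃ U, clauses ∧ block`, for every such force.

References: R. Temam, *Navier–Stokes Equations* (1979), Ch. II §1, Thm. 1.2, (1.25)–(1.30);
P. Constantin, C. Foias (1988), Ch. 8 (8.3)–(8.7); J. C. Robinson, J. L. Rodrigo, W. Sadowski
(2016) §4.1.
-/

noncomputable section

-- `Summit.<Summit>.<Problem>` is the tree's mandated summit-side namespace (CONVENTIONS §2); deliberate duplicate.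
set_option linter.dupNamespace false

namespace Summit.AnomalousDissipation.AnomalousDissipation.Theorems.UniformWorkFloorTrap

open scoped InnerProductSpace ENNReal
open MeasureTheory Filter Set UnitAddTorus
open Literature.Analysis.FunctionSpaces Literature.Analysis.FunctionSpaces.Torus
open Literature.Analysis.FluidPDE
open Summit.AnomalousDissipation.AnomalousDissipation.Theorems.UniformWorkFloorTrap.Sketch (stub_steadyTransfer)

variable {ν : ℝ} {m N : ℕ} {f U : UnitAddTorus (Fin 3) → EuclideanSpace ℝ (Fin 3)}

/-! ## §1 Constant test fields -/

/-- The convective derivative of a constant field vanishes: `(U·∇)c = 0`. [folklore] -/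
theorem convect_const_right (U : UnitAddTorus (Fin 3) → EuclideanSpace ℝ (Fin 3)) (c : EuclideanSpace ℝ (Fin 3))
    (x : UnitAddTorus (Fin 3)) : Torus.convect U (fun _ => c) x = 0 := by
  unfold Torus.convect Torus.fderiv
  have h : liftAt (fun _ : UnitAddTorus (Fin 3) => c) x = fun _ => c := by
    funext v; rfl
  rw [h]
  simp

/-- Partial derivatives of a constant field vanish. [folklore] -/
theorem partialDeriv_const_field {F : Type*} [NormedAddCommGroup F] [NormedSpace ℝ F] (i : Fin 3) (c : F) :
    Torus.partialDeriv i (fun _ : UnitAddTorus (Fin 3) => c) = fun _ => 0 := by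
  funext x
  simp [Torus.partialDeriv, Torus.lineDeriv]

/-- The Laplacian of a constant field vanishes. [folklore] -/
theorem laplacian_const_field (c : EuclideanSpace ℝ (Fin 3)) (x : UnitAddTorus (Fin 3)) :
    laplacian (fun _ : UnitAddTorus (Fin 3) => c) x = 0 := by
  rw [laplacian_eq_sum_partialDeriv_partialDeriv (isSmooth_const c)]
  refine Finset.sum_eq_zero fun i _ => ?_
  rw [partialDeriv_const_field i c, partialDeriv_const_field i (0 : EuclideanSpace ℝ (Fin 3))]

/-- A constant field is divergence free. [folklore] -/
theorem isDivFree_const_field (c : EuclideanSpace ℝ (Fin 3)) : IsDivFree (fun _ : UnitAddTorus (Fin 3) => c) := by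
  intro x
  unfold divergence
  refine Finset.sum_eq_zero fun i _ => ?_
  have h := congrFun (partialDeriv_const_field (F := ℝ) i (c i)) x
  exact h

/-! ## §2 From punctured-band-limited tests to all Galerkin modes -/

/-- **Dictionary.** Let `f` have zero mean and be integrable, `U` smooth.  If the tested steady
expression `∫ (⟪U,(U·∇)a⟫ + ν⟪U,Δa⟫ + ⟪f,a⟫)` vanishes for every smooth divergence-free `a`
band-limited to the punctured ball `0 < |k|² ≤ N²` (the bracket of
`exists_steady_galerkin_approx`), then it vanishes for every Galerkin mode `a` of order `N`: write
`a = (a − ā) + ā` with `ā = ∫ a`; the mean-free part is punctured-band-limited, and the constant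
part tests to `⟪∫ f, ā⟫ = 0`. [folklore] -/
theorem steady_allModes_of_punctured (hf0 : HasZeroMean f) (hfi : Integrable f volume) (hU : IsSmooth U)
    (hsteady : ∀ a : UnitAddTorus (Fin 3) → EuclideanSpace ℝ (Fin 3), IsSmooth a → IsDivFree a →
      (∀ k ∉ (freqBall (d := Fin 3) N).erase 0, mFourierCoeff (EuclideanSpace.complexify ∘ a) k = 0) →
      ∫ x, (⟪U x, Torus.convect U a x⟫_ℝ + ν * ⟪U x, laplacian a x⟫_ℝ + ⟪f x, a x⟫_ℝ) = 0)
    {a : UnitAddTorus (Fin 3) → EuclideanSpace ℝ (Fin 3)} (ha : IsGalerkinMode N a) :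
    ∫ x, (⟪U x, Torus.convect U a x⟫_ℝ + ν * ⟪U x, laplacian a x⟫_ℝ + ⟪f x, a x⟫_ℝ) = 0 := by
  set c : EuclideanSpace ℝ (Fin 3) := ∫ x, a x with hc
  set b : UnitAddTorus (Fin 3) → EuclideanSpace ℝ (Fin 3) := fun x => a x - c with hb
  have has : IsSmooth a := ha.isSmooth
  have hbs : IsSmooth b := has.sub (isSmooth_const c)
  have hab : a = b + fun _ => c := by funext x; simp [hb]
  -- `b` is divergence free
  have hbdiv : IsDivFree b := by
    intro x
    have h := divergence_sub (has.isContDiff (by simp)) ((isSmooth_const c).isContDiff (by simp)) x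
    have hb' : b = a - fun _ => c := by funext y; simp [hb]
    rw [hb', h, ha.isDivFree x, isDivFree_const_field c x, sub_zero]
  -- `b` has zero mean, hence is band-limited to the punctured ball
  have hbmean : HasZeroMean b := by
    show ∫ x, b x = 0
    simp only [hb]
    rw [integral_sub has.continuous.integrable_unitAddTorus (integrable_const c), integral_const]
    simp [hc]
  have hbband : ∀ k ∉ (freqBall (d := Fin 3) N).erase 0, mFourierCoeff (EuclideanSpace.complexify ∘ b) k = 0 := by
    intro k hk
    by_cases hk0 : k = 0
    · subst hk0
      exact mFourierCoeff_complexify_zero_of_hasZeroMean hbs.continuous.integrable_unitAddTorus hbmean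
    · have hkball : k ∉ freqBall (d := Fin 3) N := fun h => hk (Finset.mem_erase.2 ⟨hk0, h⟩)
      have hak : mFourierCoeff (EuclideanSpace.complexify ∘ a) k = 0 :=
        ha.mFourierCoeff_eq_zero (not_mem_freqBall.1 hkball)
      -- the coefficient of the constant at `k ≠ 0` vanishes
      have hck : mFourierCoeff (EuclideanSpace.complexify ∘ fun _ : UnitAddTorus (Fin 3) => c) k = 0 := by
        rw [mFourierCoeff_eq_integral_volume]
        simp only [Function.comp_apply]
        rw [integral_smul_const, integral_mFourier, if_neg (neg_ne_zero.2 hk0), zero_smul]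
      have hsplit : (EuclideanSpace.complexify ∘ b) = fun x =>
          (EuclideanSpace.complexify ∘ a) x - (EuclideanSpace.complexify ∘ fun _ : UnitAddTorus (Fin 3) => c) x := by
        funext x
        simp [hb, map_sub]
      rw [hsplit, mFourierCoeff_eq_integral_volume]
      simp_rw [smul_sub]
      rw [integral_sub, ← mFourierCoeff_eq_integral_volume, ← mFourierCoeff_eq_integral_volume, hak, hck, sub_zero]
      · exact ((mFourier (-k)).continuous.smul (EuclideanSpace.complexify.continuous.comp has.continuous)).integrable_unitAddTorus
      · exact ((mFourier (-k)).continuous.smul continuous_const).integrable_unitAddTorus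
  have hbtest := hsteady b hbs hbdiv hbband
  -- pointwise: the integrand for `a` is the integrand for `b` plus `⟪f x, c⟫`
  have hpt : ∀ x, ⟪U x, Torus.convect U a x⟫_ℝ + ν * ⟪U x, laplacian a x⟫_ℝ + ⟪f x, a x⟫_ℝ =
      (⟪U x, Torus.convect U b x⟫_ℝ + ν * ⟪U x, laplacian b x⟫_ℝ + ⟪f x, b x⟫_ℝ) + ⟪f x, c⟫_ℝ := by
    intro x
    have h1 : Torus.convect U a x = Torus.convect U b x := by
      unfold Torus.convect
      rw [hab, fderiv_add (hbs.isContDiff (by simp)) ((isSmooth_const c).isContDiff (by simp))]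
      simp only [FunLike.coe_add, Pi.add_apply]
      have := convect_const_right U c x
      unfold Torus.convect at this
      rw [this, add_zero]
    have h2 : laplacian a x = laplacian b x := by
      rw [hab, laplacian_add_apply hbs (isSmooth_const c), laplacian_const_field, add_zero]
    have h3 : ⟪f x, a x⟫_ℝ = ⟪f x, b x⟫_ℝ + ⟪f x, c⟫_ℝ := by
      rw [← inner_add_right]
      congr 1
      simp [hb]
    rw [h1, h2, h3]
    ring
  simp_rw [hpt]
  have iB : Integrable (fun x => ⟪U x, Torus.convect U b x⟫_ℝ + ν * ⟪U x, laplacian b x⟫_ℝ + ⟪f x, b x⟫_ℝ) volume :=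
    ((hU.inner (hU.convect hbs)).integrable.add (((hU.inner hbs.laplacian).integrable).const_mul ν)).add
      (integrable_inner_of_continuous hfi hbs.continuous)
  have iC : Integrable (fun x => ⟪f x, c⟫_ℝ) volume := hfi.inner_const c
  rw [integral_add iB iC, hbtest, zero_add]
  have hmean0 : ∫ x, f x = 0 := hf0
  simp_rw [real_inner_comm c]
  rw [integral_inner hfi c, hmean0, inner_zero_right]

/-! ## §3 Every Galerkin steady state is bounded away from zero -/

/-- **A uniform bound for the gradient of a smooth field**: `∑ᵢ ‖∂ᵢ f(x)‖ ≤ M` for all `x`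
(continuity on the compact torus). [folklore] -/
theorem exists_bound_sum_norm_partialDeriv (hf : IsSmooth f) :
    ∃ M : ℝ, 0 ≤ M ∧ ∀ x : UnitAddTorus (Fin 3), ∑ i, ‖Torus.partialDeriv i f x‖ ≤ M := by
  have hc : Continuous fun x : UnitAddTorus (Fin 3) => ∑ i, ‖Torus.partialDeriv i f x‖ :=
    continuous_finsetSum _ fun i _ => (hf.partialDeriv i).continuous.norm
  obtain ⟨M, hM⟩ := isCompact_univ.exists_bound_of_continuousOn hc.continuousOn
  refine ⟨max M 0, le_max_right _ _, fun x => ?_⟩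
  have h := hM x (mem_univ x)
  rw [Real.norm_eq_abs, abs_of_nonneg (Finset.sum_nonneg fun i _ => norm_nonneg _)] at h
  exact h.trans (le_max_left _ _)

/-- **Lower bound from the self-test with the force.** If `U` is smooth, `f` is a smooth
divergence-free field, `M` bounds `∑ᵢ‖∂ᵢf‖` pointwise, and the tested steady equation holds with
the test field `a := f`, then `∫‖f‖² ≤ M ∫‖U‖² + |ν| ‖Δf‖₂ (∫‖U‖²)^{1/2}`:
`∫‖f‖² = −∫⟪U,(U·∇)f⟫ − ν∫⟪U,Δf⟫`, `|⟪U,(U·∇)f⟫| ≤ M‖U‖²`, Cauchy–Schwarz. [folklore] -/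
theorem energy_lower_bound_of_steady (hU : IsSmooth U) (hf : IsSmooth f) {M : ℝ}
    (hM : ∀ x : UnitAddTorus (Fin 3), ∑ i, ‖Torus.partialDeriv i f x‖ ≤ M)
    (htest : ∫ x, (⟪U x, Torus.convect U f x⟫_ℝ + ν * ⟪U x, laplacian f x⟫_ℝ + ⟪f x, f x⟫_ℝ) = 0) :
    ∫ x, ‖f x‖ ^ 2 ≤ M * (∫ x, ‖U x‖ ^ 2) +
      |ν| * Real.sqrt (∫ x, ‖laplacian f x‖ ^ 2) * Real.sqrt (∫ x, ‖U x‖ ^ 2) := by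
  have iA : Integrable (fun x => ⟪U x, Torus.convect U f x⟫_ℝ) volume := (hU.inner (hU.convect hf)).integrable
  have iB : Integrable (fun x => ν * ⟪U x, laplacian f x⟫_ℝ) volume :=
    (hU.inner hf.laplacian).integrable.const_mul ν
  have iC : Integrable (fun x => ⟪f x, f x⟫_ℝ) volume := (hf.inner hf).integrable
  have iAB : Integrable (fun x => ⟪U x, Torus.convect U f x⟫_ℝ + ν * ⟪U x, laplacian f x⟫_ℝ) volume := iA.add iB
  rw [integral_add iAB iC, integral_add iA iB, integral_const_mul] at htest
  simp_rw [real_inner_self_eq_norm_sq] at htest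
  -- the stress term
  have hA : |∫ x, ⟪U x, Torus.convect U f x⟫_ℝ| ≤ M * (∫ x, ‖U x‖ ^ 2) := by
    rw [← integral_const_mul]
    refine (abs_integral_le_integral_abs).trans (integral_mono iA.abs (hU.norm_sq.integrable.const_mul M) fun x => ?_)
    calc |⟪U x, Torus.convect U f x⟫_ℝ| ≤ ‖U x‖ * ‖Torus.convect U f x‖ := abs_real_inner_le_norm _ _
      _ ≤ ‖U x‖ * (‖U x‖ * ∑ i, ‖Torus.partialDeriv i f x‖) :=
          mul_le_mul_of_nonneg_left (norm_convect_le U (hf.isContDiff (by simp)) x) (norm_nonneg _)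
      _ ≤ ‖U x‖ * (‖U x‖ * M) := by gcongr; exact hM x
      _ = M * ‖U x‖ ^ 2 := by ring
  -- the viscous term
  have hB : |∫ x, ⟪U x, laplacian f x⟫_ℝ| ≤
      Real.sqrt (∫ x, ‖U x‖ ^ 2) * Real.sqrt (∫ x, ‖laplacian f x‖ ^ 2) :=
    abs_integral_inner_le_sqrt_sq_mul_sqrt_sq (hU.memLp 2) (hf.laplacian.memLp 2)
  have hB' : |ν * ∫ x, ⟪U x, laplacian f x⟫_ℝ| ≤
      |ν| * Real.sqrt (∫ x, ‖laplacian f x‖ ^ 2) * Real.sqrt (∫ x, ‖U x‖ ^ 2) := by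
    rw [abs_mul, mul_assoc, mul_comm (Real.sqrt (∫ x, ‖laplacian f x‖ ^ 2))]
    exact mul_le_mul_of_nonneg_left hB (abs_nonneg ν)
  have h1 := (abs_le.1 hA).1
  have h2 := (abs_le.1 hB').1
  linarith

/-! ## §4 The ν-dependent trap -/

/-- **Trapped steady family at fixed viscosity.**  Let `f` be a mean-zero Galerkin-mode force of
order `m` with `∫‖f‖² > 0`, and `ν > 0`.  There are `E` and `ε₀ > 0` (depending on `ν` and `f`)
such that for EVERY `N ≥ m` some global Galerkin trajectory of order `N` stays in
`{kineticEnergy ≤ E} ∩ {(f,·) ≥ ε₀}` for all `t ≥ 0` — the constant curve at Temam's stationary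
Galerkin approximation `u_N` (`exists_steady_galerkin_approx`): energy `≤ ‖f‖₂²/(2(4π²ν)²)` by the
a priori bound and `|k|² ≥ 1`; loudness `(f,u_N) = ν‖∇u_N‖² ≥ 4π²ν∫‖u_N‖²` (Poincaré on the
punctured ball) `≥ ε₀` by `energy_lower_bound_of_steady`. [folklore] -/
theorem trapped_steady_family (hf : IsGalerkinMode m f) (hmean : HasZeroMean f)
    (hf0 : 0 < ∫ x, ‖f x‖ ^ 2) (hν : 0 < ν) :
    ∃ E ε₀ : ℝ, 0 < ε₀ ∧ ∀ N : ℕ, m ≤ N →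
      ∃ V : ℝ → UnitAddTorus (Fin 3) → EuclideanSpace ℝ (Fin 3), Torus.IsGalerkinTrajectory ν f N V ∧
        ∀ t : ℝ, 0 ≤ t → kineticEnergy (V t) ≤ E ∧ ε₀ ≤ ∫ x, ⟪f x, V t x⟫_ℝ := by
  have hfs : IsSmooth f := hf.isSmooth
  have hf2 : MemLp f 2 volume := hfs.memLp 2
  have hfi : Integrable f volume := hf2.integrable one_le_two
  obtain ⟨M, hM0, hM⟩ := exists_bound_sum_norm_partialDeriv hfs
  set F2 : ℝ := ∫ x, ‖f x‖ ^ 2 with hF2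
  set L : ℝ := Real.sqrt (∫ x, ‖laplacian f x‖ ^ 2) with hL
  have hL0 : 0 ≤ L := Real.sqrt_nonneg _
  -- the energy lower bound `Y₀` and the block constants
  set Y₀ : ℝ := min (F2 / (2 * (M + 1))) ((F2 / (2 * (ν * L + 1))) ^ 2) with hY₀
  have hY₀pos : 0 < Y₀ := lt_min (div_pos hf0 (by positivity)) (pow_pos (div_pos hf0 (by positivity)) 2)
  set E : ℝ := F2 / (2 * (4 * Real.pi ^ 2 * ν) ^ 2) with hE
  set ε₀ : ℝ := 4 * Real.pi ^ 2 * ν * Y₀ with hε₀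
  have hε₀pos : 0 < ε₀ := by positivity
  refine ⟨E, ε₀, hε₀pos, fun N hmN => ?_⟩
  -- Temam's stationary Galerkin approximation of order `N`
  obtain ⟨C, hCsymm, hCT, hCsupp, hapriori, henergy, htest⟩ := exists_steady_galerkin_approx hν hf2 N
  set S : Finset (Fin 3 → ℤ) := (freqBall (d := Fin 3) N).erase 0 with hS
  have hSsym : ∀ k ∈ S, -k ∈ S := neg_mem_freqBall_erase_zero
  have hS0 : (0 : Fin 3 → ℤ) ∉ S := by simp [hS]
  set U : UnitAddTorus (Fin 3) → EuclideanSpace ℝ (Fin 3) := realTrigPoly S C with hUdef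
  have hUs : IsSmooth U := isSmooth_realTrigPoly _ _
  have hUT : IsTransversal S C := fun k _ => hCT k
  have hUdiv : IsDivFree U := isDivFree_realTrigPoly hUT
  have hUband : ∀ k ∉ S, mFourierCoeff (EuclideanSpace.complexify ∘ U) k = 0 :=
    fun k hk => mFourierCoeff_realTrigPoly_eq_zero hSsym hCsymm hk
  have hUmode : IsGalerkinMode N U :=
    ⟨hUs, hUdiv, fun k hk => hUband k fun hmem => not_mem_freqBall.2 hk (Finset.mem_of_mem_erase hmem)⟩
  -- all Galerkin modes are admissible tests
  have hsteady : ∀ a : UnitAddTorus (Fin 3) → EuclideanSpace ℝ (Fin 3), IsGalerkinMode N a →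
      ∫ x, (⟪U x, Torus.convect U a x⟫_ℝ + ν * ⟪U x, laplacian a x⟫_ℝ + ⟪f x, a x⟫_ℝ) = 0 :=
    fun a ha => steady_allModes_of_punctured hmean hfi hUs htest ha
  -- spectral bookkeeping: `∫‖U‖² = Σ‖C k‖²`, `‖∇U‖² = 4π² Σ|k|²‖C k‖²`, `|k|² ≥ 1` on `S`
  have hnormsq : ∫ x, ‖U x‖ ^ 2 = ∑ k ∈ S, ‖C k‖ ^ 2 := integral_norm_sq_realTrigPoly hSsym hCsymm
  have hgrad : (eGradNormSq U).toReal = 4 * Real.pi ^ 2 * ∑ k ∈ S, freqNormSq k * ‖C k‖ ^ 2 :=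
    toReal_eGradNormSq_realTrigPoly hSsym hCsymm
  have hpoinc : ∑ k ∈ S, ‖C k‖ ^ 2 ≤ ∑ k ∈ S, freqNormSq k * ‖C k‖ ^ 2 := by
    refine Finset.sum_le_sum fun k hk => ?_
    have hk0 : k ≠ 0 := (Finset.mem_erase.1 hk).1
    have h1 := Torus.one_le_freqNormSq_of_ne_zero hk0
    nlinarith [sq_nonneg ‖C k‖]
  -- the energy cap
  have hKE : kineticEnergy U ≤ E := by
    rw [kineticEnergy_realTrigPoly hSsym hCsymm, hE]
    have hν4 : 0 < (4 * Real.pi ^ 2 * ν) ^ 2 := by positivity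
    have h2 : ∑ k ∈ S, freqNormSq k * ‖C k‖ ^ 2 ≤ F2 / (4 * Real.pi ^ 2 * ν) ^ 2 := by
      rw [le_div_iff₀ hν4, mul_comm]
      exact hapriori
    have h3 : ∑ k ∈ S, ‖C k‖ ^ 2 ≤ F2 / (4 * Real.pi ^ 2 * ν) ^ 2 := hpoinc.trans h2
    calc 2⁻¹ * ∑ k ∈ S, ‖C k‖ ^ 2 ≤ 2⁻¹ * (F2 / (4 * Real.pi ^ 2 * ν) ^ 2) := by gcongr
      _ = F2 / (2 * (4 * Real.pi ^ 2 * ν) ^ 2) := by ring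
  -- the energy lower bound `Y₀ ≤ ∫‖U‖²`
  have hfband : ∀ k ∉ S, mFourierCoeff (EuclideanSpace.complexify ∘ f) k = 0 := by
    intro k hk
    by_cases hk0 : k = 0
    · subst hk0
      exact mFourierCoeff_complexify_zero_of_hasZeroMean hfi hmean
    · have hkball : k ∉ freqBall (d := Fin 3) N := fun h => hk (Finset.mem_erase.2 ⟨hk0, h⟩)
      have hlt : ((N : ℕ) : ℝ) ^ 2 < freqNormSq k := not_mem_freqBall.1 hkball
      have hmN' : ((m : ℕ) : ℝ) ^ 2 ≤ ((N : ℕ) : ℝ) ^ 2 := by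
        gcongr
      exact hf.mFourierCoeff_eq_zero (hmN'.trans_lt hlt)
  have hselftest := htest f hfs hf.isDivFree hfband
  have hlow := energy_lower_bound_of_steady hUs hfs hM hselftest
  rw [abs_of_pos hν] at hlow
  set Y : ℝ := ∫ x, ‖U x‖ ^ 2 with hY
  have hYnn : 0 ≤ Y := by rw [hY]; exact integral_nonneg fun x => sq_nonneg _
  have hlow' : F2 ≤ M * Y + ν * L * Real.sqrt Y := by
    have := hlow
    simp only [← hL, ← hF2] at this
    linarith
  have hYlow : Y₀ ≤ Y := by
    by_contra hlt
    push Not at hlt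
    -- `M Y < F2/2` and `ν L √Y < F2/2`
    have hY1 : Y < F2 / (2 * (M + 1)) := hlt.trans_le (min_le_left _ _)
    have hY2 : Y < (F2 / (2 * (ν * L + 1))) ^ 2 := hlt.trans_le (min_le_right _ _)
    have hMY : M * Y < F2 / 2 := by
      have h1 : M * Y ≤ (M + 1) * Y := by nlinarith
      have h2 : (M + 1) * Y < (M + 1) * (F2 / (2 * (M + 1))) := by
        exact mul_lt_mul_of_pos_left hY1 (by positivity)
      have h3 : (M + 1) * (F2 / (2 * (M + 1))) = F2 / 2 := by field_simp
      linarith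
    have hsqrt : Real.sqrt Y < F2 / (2 * (ν * L + 1)) := by
      rw [Real.sqrt_lt' (div_pos hf0 (by positivity))]
      exact hY2
    have hνLY : ν * L * Real.sqrt Y < F2 / 2 := by
      have h1 : ν * L * Real.sqrt Y ≤ (ν * L + 1) * Real.sqrt Y := by
        nlinarith [Real.sqrt_nonneg Y]
      have h2 : (ν * L + 1) * Real.sqrt Y < (ν * L + 1) * (F2 / (2 * (ν * L + 1))) :=
        mul_lt_mul_of_pos_left hsqrt (by positivity)
      have h3 : (ν * L + 1) * (F2 / (2 * (ν * L + 1))) = F2 / 2 := by field_simp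
      linarith
    linarith
  -- loudness `ε₀ ≤ (f, U) = ν‖∇U‖²`
  have hW : ε₀ ≤ ∫ x, ⟪f x, U x⟫_ℝ := by
    rw [← henergy, hgrad, hε₀]
    have : 4 * Real.pi ^ 2 * ν * Y₀ ≤ 4 * Real.pi ^ 2 * ν * ∑ k ∈ S, freqNormSq k * ‖C k‖ ^ 2 := by
      gcongr
      calc Y₀ ≤ Y := hYlow
        _ = ∑ k ∈ S, ‖C k‖ ^ 2 := hnormsq
        _ ≤ _ := hpoinc
    linarith
  -- transfer to a trapped (constant) trajectory
  exact stub_steadyTransfer ν N f U E ε₀ hν.le hf2 hUmode hsteady hKE hW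

/-- **The crux with ν-dependent block constants is a theorem.**  For every mean-zero Galerkin-mode
force `f` of order `m` with `∫‖f‖² > 0`: for every `ν > 0` there are `E` and `ε₀ > 0` and an order
`N₀` (`= m`) such that for every `N ≥ N₀` some global Galerkin trajectory of order `N` — clauses
(1)–(4) of the crux verbatim — satisfies `kineticEnergy (U t) ≤ E` and `ε₀ ≤ (f, U t)` for all
`t ≥ 0`.  Compared with `WazewskiBlock.UniformWorkFloorTrap` only the order of `∃ E ε₀` and `∀ ν`
is swapped: the open content of the crux is exactly the `ν`-uniformity of `(E, ε₀)`. [folklore] -/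
theorem uniformWorkFloorTrap_nuDependent (hf : IsGalerkinMode m f) (hmean : HasZeroMean f)
    (hf0 : 0 < ∫ x, ‖f x‖ ^ 2) :
    ∀ ν : ℝ, 0 < ν → ∃ E ε₀ : ℝ, 0 < ε₀ ∧ ∃ N₀ : ℕ, ∀ N : ℕ, N₀ ≤ N →
      ∃ U : ℝ → UnitAddTorus (Fin 3) → EuclideanSpace ℝ (Fin 3),
        (ContinuousOn (stLift U) (Set.Ici 0 ×ˢ Set.univ) ∧
          (∀ t : ℝ, 0 ≤ t → (IsSmooth (U t) ∧ IsDivFree (U t) ∧ ∀ k : Fin 3 → ℤ,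
            ((N : ℕ) : ℝ) ^ 2 < freqNormSq k → mFourierCoeff (EuclideanSpace.complexify ∘ (U t)) k = 0) ∧
            IsWeaklyDivFree (U t)) ∧
          (∀ a : UnitAddTorus (Fin 3) → EuclideanSpace ℝ (Fin 3), (IsSmooth a ∧ IsDivFree a ∧
            ∀ k : Fin 3 → ℤ, ((N : ℕ) : ℝ) ^ 2 < freqNormSq k →
              mFourierCoeff (EuclideanSpace.complexify ∘ a) k = 0) → ∀ s t : ℝ, 0 ≤ s → s ≤ t →
            (∫ x, ⟪U t x, a x⟫_ℝ) - ∫ x, ⟪U s x, a x⟫_ℝ =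
              ∫ τ in s..t, ∫ x, (⟪U τ x, Torus.convect (U τ) a x⟫_ℝ + ν * ⟪U τ x, laplacian a x⟫_ℝ +
                ⟪f x, a x⟫_ℝ)) ∧
          (∀ s t : ℝ, 0 ≤ s → s ≤ t → kineticEnergy (U t) + ν * (∫⁻ τ in Set.Ioo s t,
            eGradNormSq (U τ)).toReal = kineticEnergy (U s) + ∫ τ in s..t, ∫ x, ⟪f x, U τ x⟫_ℝ)) ∧
        ∀ t : ℝ, 0 ≤ t → kineticEnergy (U t) ≤ E ∧ ε₀ ≤ ∫ x, ⟪f x, U t x⟫_ℝ := by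
  intro ν hν
  obtain ⟨E, ε₀, hε₀, h⟩ := trapped_steady_family hf hmean hf0 hν
  refine ⟨E, ε₀, hε₀, m, fun N hN => ?_⟩
  obtain ⟨V, hV, hB⟩ := h N hN
  exact ⟨V, Torus.isGalerkinTrajectory_iff.1 hV, hB⟩

/-- **Registered sub-goal `nuDependentTrap_glue` of stmt-AnomalousDissipation-10353** (binder-free form of
`uniformWorkFloorTrap_nuDependent`, through which this file lands `--supports`): for every mean-zero Galerkin-mode
force `f` of order `m` with `∫‖f‖² > 0` and every `ν > 0` there are `E`, `ε₀ > 0`, `N₀` such that every order `N ≥ N₀`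
carries a global Galerkin trajectory (clauses (1)–(4) of the crux verbatim) trapped in `{kineticEnergy ≤ E} ∩ {(f,·) ≥ ε₀}`
for all `t ≥ 0`. [folklore] -/
theorem nuDependentTrap_glue : ∀ (m : ℕ) (f : UnitAddTorus (Fin 3) → EuclideanSpace ℝ (Fin 3)), IsGalerkinMode m f → HasZeroMean f → 0 < (∫ x, ‖f x‖ ^ 2) → ∀ ν : ℝ, 0 < ν → ∃ E ε₀ : ℝ, 0 < ε₀ ∧ ∃ N₀ : ℕ, ∀ N : ℕ, N₀ ≤ N → ∃ U : ℝ → UnitAddTorus (Fin 3) → EuclideanSpace ℝ (Fin 3), (ContinuousOn (stLift U) (Set.Ici 0 ×ˢ Set.univ) ∧ (∀ t : ℝ, 0 ≤ t → (IsSmooth (U t) ∧ IsDivFree (U t) ∧ ∀ k : Fin 3 → ℤ, ((N : ℕ) : ℝ) ^ 2 < freqNormSq k → mFourierCoeff (EuclideanSpace.complexify ∘ (U t)) k = 0) ∧ IsWeaklyDivFree (U t)) ∧ (∀ a : UnitAddTorus (Fin 3) → EuclideanSpace ℝ (Fin 3), (IsSmooth a ∧ IsDivFree a ∧ ∀ k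 : Fin 3 → ℤ, ((N : ℕ) : ℝ) ^ 2 < freqNormSq k → mFourierCoeff (EuclideanSpace.complexify ∘ a) k = 0) → ∀ s t : ℝ, 0 ≤ s → s ≤ t → (∫ x, ⟪U t x, a x⟫_ℝ) - ∫ x, ⟪U s x, a x⟫_ℝ = ∫ τ in s..t, ∫ x, (⟪U τ x, Torus.convect (U τ) a x⟫_ℝ + ν * ⟪U τ x, laplacian a x⟫_ℝ + ⟪f x, a x⟫_ℝ)) ∧ (∀ s t : ℝ, 0 ≤ s → s ≤ t → kineticEnergy (U t) + ν * (∫⁻ τ in Set.Ioo s t, eGradNormSq (U τ)).toReal = kineticEnergy (U s) + ∫ τ in s..t, ∫ x, ⟪f x, U τ x⟫_ℝ)) ∧ ∀ t : ℝ, 0 ≤ t → kineticEnergy (U t) ≤ E ∧ ε₀ ≤ ∫ x, ⟪f x, U t x⟫_ℝ :=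
  fun _ _ hf hmean hf0 => uniformWorkFloorTrap_nuDependent hf hmean hf0

end Summit.AnomalousDissipation.AnomalousDissipation.Theorems.UniformWorkFloorTrap

end
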